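import Mathlib
import Summits.MatrixMultiplication.Statement
import Summits.MatrixMultiplication.MatrixMultiplication.Theorems.GraphEquationsDegreeLadder
import Summits.MatrixMultiplication.MatrixMultiplication.Theorems.GraphEquationsOmegaCubic

/-!
# The degree ladder in `ω`-currency and its LIMIT bridge (`GraphEquations`, kernel M74)

Decomp-mm node «GraphEquations» (lens 5: finite/base range + asymptotic regime + bridge); attacked
leaf `MultiplicityReduction` (stmt-MatrixMultiplication-27806); target VERBATIM:
`_root_.MatrixMultiplication`.

M67 split `MultiplicityReduction ↔ (∀ D, EFM_D) ∧ BoundedDegreeReduction`.  Two refinements.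

* **The dials `ω_D`** (`omegaDeg D := inf {β : EqAdmissibleDeg D β}`, `D ≥ 2`): the unconditional
  chain `2 ≤ ω_v ≤ ω_D' ≤ ω_D ≤ ω₃ = ω₂ = ω < 2.48` (`D ≤ D'`), `EFM_D ↔ ω_D = ω`
  (`efmDeg_iff_omegaDeg_eq`), `BDR ↔ ∃ D, ω_D = ω_v` (`boundedDegreeReduction_iff`): the bridge of
  M67 says the infimum `inf_D ω_D` is ATTAINED at `ω_v`.
* **The limit bridge** `LimitDegreeReduction` (the degree may depend on the target exponent) —
  typed by critic g19 (probe `L5_g42e`, items w3a–w5) and recorded here at the writer's request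
  (G47): `BDR → LDR`, `LDR ↔ ∀ β > ω_v, ∃ D, ω_D < β` (i.e. `inf_D ω_D = ω_v`, NOT necessarily
  attained), and the split stays EXACT: `MultiplicityReduction ↔ (∀ D ≥ 4, EFM_D) ∧ LDR`
  (`multiplicityReduction_iff_degree_ladder_from_four`; rungs `≤ 3` are theorems, M56/M67), hence
  `S ↔ V ∧ (∀ D ≥ 4, EFM_D) ∧ LDR`.  Under the rungs the two bridges coincide
  (`boundedDegreeReduction_iff_limit_of_rungs`).

No `sorry`.  Sources: [BurgisserClausenShokrollahi1997, §15–16]; critic g19 `L5_g42e` (w3).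
-/

set_option linter.dupNamespace false

noncomputable section

namespace Summit.MatrixMultiplication.MatrixMultiplication.Theorems.GraphEquations

open Literature.Computability.AlgebraicComplexity

/-! ## The dials `ω_D` -/

/-- Admissible exponents of correct systems of test degree `≤ D`. -/
def degExponents (D : ℕ) : Set ℝ := {β | EqAdmissibleDeg D β}

/-- `ω_D := inf degExponents D` (meaningful for `D ≥ 2`). -/
def omegaDeg (D : ℕ) : ℝ := sInf (degExponents D)

/-- Monotonicity of `EqAdmissibleDeg D` in the exponent. -/
theorem EqAdmissibleDeg.mono_exp {D : ℕ} {β β' : ℝ} (h : EqAdmissibleDeg D β) (hββ' : β ≤ β') :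
    EqAdmissibleDeg D β' := by
  obtain ⟨c, hc⟩ := h
  refine ⟨max c 0, fun n hn => ?_⟩
  obtain ⟨E, hE, hdeg, hcost⟩ := hc n hn
  refine ⟨E, hE, hdeg, hcost.trans ?_⟩
  have hn1 : (1 : ℝ) ≤ n := by exact_mod_cast hn
  have h1 : (n : ℝ) ^ β ≤ (n : ℝ) ^ β' := Real.rpow_le_rpow_of_exponent_le hn1 hββ'
  have h0 : 0 ≤ (n : ℝ) ^ β := Real.rpow_nonneg (by positivity) _
  calc c * (n : ℝ) ^ β ≤ max c 0 * (n : ℝ) ^ β := mul_le_mul_of_nonneg_right (le_max_left c 0) h0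
    _ ≤ max c 0 * (n : ℝ) ^ β' := mul_le_mul_of_nonneg_left h1 (le_max_right c 0)

/-- Every `β > ω` is admissible in every degree `D ≥ 2` (the generator systems are quadratic). -/
theorem eqAdmissibleDeg_of_omega_lt {D : ℕ} (hD : 2 ≤ D) {β : ℝ} (hβ : omega ℂ < β) :
    EqAdmissibleDeg D β :=
  (show EqAdmissibleDeg 2 β from eqAdmissibleQuad_of_omega_lt hβ).mono_deg hD

/-- `degExponents D` is non-empty for `D ≥ 2`. -/
theorem degExponents_nonempty {D : ℕ} (hD : 2 ≤ D) : (degExponents D).Nonempty :=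
  ⟨5 / 2, eqAdmissibleDeg_of_omega_lt hD (lt_trans (BCS1997_cor_15_33 ℂ) (by norm_num))⟩

/-- Bounded-degree systems are systems. -/
theorem degExponents_subset_verifExponents (D : ℕ) : degExponents D ⊆ verifExponents :=
  fun _ h => EqAdmissibleDeg.eqAdmissible h

/-- The dial sets grow with the degree. -/
theorem degExponents_mono {D D' : ℕ} (hDD' : D ≤ D') : degExponents D ⊆ degExponents D' :=
  fun _ h => EqAdmissibleDeg.mono_deg h hDD'

/-- `degExponents D` is bounded below (by `2`). -/
theorem degExponents_bddBelow (D : ℕ) : BddBelow (degExponents D) :=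
  verifExponents_bddBelow.mono (degExponents_subset_verifExponents D)

/-- `ω_D ≤ β` for every `β` admissible in degree `D`. -/
theorem omegaDeg_le_of_eqAdmissibleDeg {D : ℕ} {β : ℝ} (h : EqAdmissibleDeg D β) : omegaDeg D ≤ β :=
  csInf_le (degExponents_bddBelow D) h

/-- Every `β > ω_D` is admissible in degree `D` (`D ≥ 2`). -/
theorem eqAdmissibleDeg_of_omegaDeg_lt {D : ℕ} (hD : 2 ≤ D) {β : ℝ} (h : omegaDeg D < β) :
    EqAdmissibleDeg D β := by
  obtain ⟨β', hβ', hlt⟩ := exists_lt_of_csInf_lt (degExponents_nonempty hD) h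
  exact EqAdmissibleDeg.mono_exp hβ' hlt.le

/-- `ω_v ≤ ω_D`. -/
theorem omegaVerif_le_omegaDeg {D : ℕ} (hD : 2 ≤ D) : omegaVerif ≤ omegaDeg D :=
  csInf_le_csInf verifExponents_bddBelow (degExponents_nonempty hD)
    (degExponents_subset_verifExponents D)

/-- `ω_D' ≤ ω_D` for `2 ≤ D ≤ D'`: the dials decrease along the ladder. -/
theorem omegaDeg_antitone {D D' : ℕ} (hD : 2 ≤ D) (hDD' : D ≤ D') : omegaDeg D' ≤ omegaDeg D :=
  csInf_le_csInf (degExponents_bddBelow D') (degExponents_nonempty hD) (degExponents_mono hDD')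

/-- `ω_D ≤ ω`. -/
theorem omegaDeg_le_omega {D : ℕ} (hD : 2 ≤ D) : omegaDeg D ≤ omega ℂ :=
  le_of_forall_gt_imp_ge_of_dense fun _ hβ =>
    omegaDeg_le_of_eqAdmissibleDeg (eqAdmissibleDeg_of_omega_lt hD hβ)

/-- `2 ≤ ω_D`. -/
theorem two_le_omegaDeg {D : ℕ} (hD : 2 ≤ D) : 2 ≤ omegaDeg D :=
  two_le_omegaVerif.trans (omegaVerif_le_omegaDeg hD)

/-- `ω₃` of M47 is the third dial. -/
theorem omegaDeg_three : omegaDeg 3 = omegaCubic := rfl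

/-- `EFM_D ↔ ω ≤ ω_D`. -/
theorem efmDeg_iff_omega_le_omegaDeg {D : ℕ} (hD : 2 ≤ D) :
    EquationsForceMultiplicationDeg D ↔ omega ℂ ≤ omegaDeg D := by
  constructor
  · intro h
    exact le_csInf (degExponents_nonempty hD) fun β hβ =>
      h β (two_le_of_eqAdmissible (EqAdmissibleDeg.eqAdmissible hβ)) hβ
  · intro h β _ hβ
    exact h.trans (omegaDeg_le_of_eqAdmissibleDeg hβ)

/-- **`EFM_D ↔ ω_D = ω`**: the rung `D` of the ladder is the closing of the dial `ω_D`. -/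
theorem efmDeg_iff_omegaDeg_eq {D : ℕ} (hD : 2 ≤ D) :
    EquationsForceMultiplicationDeg D ↔ omegaDeg D = omega ℂ := by
  rw [efmDeg_iff_omega_le_omegaDeg hD]
  exact ⟨fun h => le_antisymm (omegaDeg_le_omega hD) h, fun h => h.ge⟩

/-- **`ω₂ = ω₃ = ω`** in dial form (M56/M67). -/
theorem omegaDeg_eq_omega_of_le_three {D : ℕ} (h2 : 2 ≤ D) (h3 : D ≤ 3) : omegaDeg D = omega ℂ :=
  (efmDeg_iff_omegaDeg_eq h2).1 (equationsForceMultiplicationDeg_of_le_three h3)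

/-- **The unconditional chain** `2 ≤ ω_v ≤ ω_D ≤ ω₄ ≤ ω₃ = ω < 2.48` for `D ≥ 4`. -/
theorem degree_ladder_chain {D : ℕ} (hD : 4 ≤ D) :
    2 ≤ omegaVerif ∧ omegaVerif ≤ omegaDeg D ∧ omegaDeg D ≤ omegaDeg 4 ∧ omegaDeg 4 ≤ omegaDeg 3 ∧
      omegaDeg 3 = omega ℂ ∧ omega ℂ < 2.48 :=
  ⟨two_le_omegaVerif, omegaVerif_le_omegaDeg (by omega), omegaDeg_antitone (by norm_num) hD,
    omegaDeg_antitone (by norm_num) (by norm_num), omegaDeg_eq_omega_of_le_three (by norm_num) le_rfl,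
    BCS1997_cor_15_33 ℂ⟩

/-- **`BDR ↔ ∃ D ≥ 2, ω_D ≤ ω_v`** (i.e. `ω_D = ω_v`: the infimum of the dials is ATTAINED at `ω_v`). -/
theorem boundedDegreeReduction_iff :
    BoundedDegreeReduction ↔ ∃ D, 2 ≤ D ∧ omegaDeg D ≤ omegaVerif := by
  constructor
  · rintro ⟨D, hD⟩
    refine ⟨max D 2, le_max_right _ _, le_of_forall_gt_imp_ge_of_dense fun β' hβ' => ?_⟩
    obtain ⟨β, hβ, hββ'⟩ := exists_between hβ'
    exact omegaDeg_le_of_eqAdmissibleDeg ((hD β (two_le_omegaVerif.trans hβ.le)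
      (eqAdmissible_of_omegaVerif_lt hβ) β' hββ').mono_deg (le_max_left _ _))
  · rintro ⟨D, hD2, hD⟩
    exact ⟨D, fun β _ hβ β' hββ' => eqAdmissibleDeg_of_omegaDeg_lt hD2
      (lt_of_le_of_lt (hD.trans (omegaVerif_le_of_eqAdmissible hβ)) hββ')⟩

/-- `BDR ↔ ∃ D ≥ 2, ω_D = ω_v`. -/
theorem boundedDegreeReduction_iff_eq :
    BoundedDegreeReduction ↔ ∃ D, 2 ≤ D ∧ omegaDeg D = omegaVerif := by
  rw [boundedDegreeReduction_iff]
  exact ⟨fun ⟨D, hD2, hD⟩ => ⟨D, hD2, le_antisymm hD (omegaVerif_le_omegaDeg hD2)⟩,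
    fun ⟨D, hD2, hD⟩ => ⟨D, hD2, hD.le⟩⟩

/-! ## The limit bridge -/

/-- **`LimitDegreeReduction`** (critic g19, w3): every admissible exponent is beaten, up to `ε`, by
systems of SOME bounded degree — the bound may depend on the target exponent.  NEC; open. -/
def LimitDegreeReduction : Prop :=
  ∀ β : ℝ, 2 ≤ β → EqAdmissible β → ∀ β' : ℝ, β < β' → ∃ D : ℕ, EqAdmissibleDeg D β'

/-- `BDR → LDR`. -/
theorem limitDegreeReduction_of_bounded (h : BoundedDegreeReduction) : LimitDegreeReduction := by
  obtain ⟨D, hD⟩ := h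
  exact fun β hβ hE β' hββ' => ⟨D, hD β hβ hE β' hββ'⟩

/-- The rungs plus the LIMIT bridge already give `H_mult`. -/
theorem multiplicityReduction_of_degree_ladder_limit (hE : ∀ D, EquationsForceMultiplicationDeg D)
    (hL : LimitDegreeReduction) : MultiplicityReduction := by
  rw [multiplicityReduction_iff_omega_le_omegaVerif]
  refine le_csInf verifExponents_nonempty fun β hβ => ?_
  have hβ2 : 2 ≤ β := two_mem_lowerBounds_verifExponents hβ
  refine le_of_forall_gt_imp_ge_of_dense fun β' hββ' => ?_
  obtain ⟨D, hD⟩ := hL β hβ2 hβ β' hββ'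
  exact hE D β' (hβ2.trans hββ'.le) hD

/-- **EXACT SPLIT with the limit bridge**: `H_mult ↔ (∀ D, EFM_D) ∧ LDR` (critic g19, w3b). -/
theorem multiplicityReduction_iff_degree_ladder_limit :
    MultiplicityReduction ↔ (∀ D, EquationsForceMultiplicationDeg D) ∧ LimitDegreeReduction :=
  ⟨fun h => ⟨efmDeg_of_multiplicityReduction h, limitDegreeReduction_of_bounded
    (multiplicityReduction_iff_degree_ladder.mp h).2⟩,
    fun h => multiplicityReduction_of_degree_ladder_limit h.1 h.2⟩

/-- **The ladder starts at rung `4`**: `H_mult ↔ (∀ D ≥ 4, EFM_D) ∧ LDR` (rungs `≤ 3` are theorems). -/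
theorem multiplicityReduction_iff_degree_ladder_from_four :
    MultiplicityReduction ↔ (∀ D, 4 ≤ D → EquationsForceMultiplicationDeg D) ∧ LimitDegreeReduction := by
  rw [multiplicityReduction_iff_degree_ladder_limit]
  refine ⟨fun h => ⟨fun D _ => h.1 D, h.2⟩, fun h => ⟨fun D => ?_, h.2⟩⟩
  by_cases hD : D ≤ 3
  · exact equationsForceMultiplicationDeg_of_le_three hD
  · exact h.1 D (by omega)

/-- `LDR` is NEC (the summit gives it). -/
theorem limitDegreeReduction_of_matrixMultiplication (hS : _root_.MatrixMultiplication) :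
    LimitDegreeReduction :=
  limitDegreeReduction_of_bounded (boundedDegreeReduction_of_matrixMultiplication hS)

/-- **THE SUMMIT THROUGH THE LADDER FROM RUNG `4`**: `S ↔ V ∧ (∀ D ≥ 4, EFM_D) ∧ LDR`. -/
theorem matrixMultiplication_iff_degree_ladder_from_four :
    _root_.MatrixMultiplication ↔ GraphEquationsQuadratic ∧
      (∀ D, 4 ≤ D → EquationsForceMultiplicationDeg D) ∧ LimitDegreeReduction := by
  rw [matrixMultiplication_iff_degree_ladder, ← multiplicityReduction_iff_degree_ladder,
    multiplicityReduction_iff_degree_ladder_from_four]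

/-- **`LDR ↔ inf_D ω_D = ω_v`**: for every `β > ω_v` some dial `ω_D` (`D ≥ 2`) is `< β`. -/
theorem limitDegreeReduction_iff :
    LimitDegreeReduction ↔ ∀ β : ℝ, omegaVerif < β → ∃ D, 2 ≤ D ∧ omegaDeg D < β := by
  constructor
  · intro h β hβ
    obtain ⟨β₀, hβ₀, hβ₀β⟩ := exists_between hβ
    obtain ⟨β₁, hβ₀₁, hβ₁β⟩ := exists_between hβ₀β
    obtain ⟨D, hD⟩ := h β₀ (two_le_omegaVerif.trans hβ₀.le) (eqAdmissible_of_omegaVerif_lt hβ₀) β₁ hβ₀₁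
    exact ⟨max D 2, le_max_right _ _,
      (omegaDeg_le_of_eqAdmissibleDeg (hD.mono_deg (le_max_left _ _))).trans_lt hβ₁β⟩
  · intro h β _ hβ β' hββ'
    obtain ⟨D, hD2, hD⟩ := h β' (lt_of_le_of_lt (omegaVerif_le_of_eqAdmissible hβ) hββ')
    exact ⟨D, eqAdmissibleDeg_of_omegaDeg_lt hD2 hD⟩

/-- Under the rungs the two bridges coincide (both are then `H_mult`). -/
theorem boundedDegreeReduction_iff_limit_of_rungs (hE : ∀ D, EquationsForceMultiplicationDeg D) :
    BoundedDegreeReduction ↔ LimitDegreeReduction :=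
  ⟨limitDegreeReduction_of_bounded, fun hL => (multiplicityReduction_iff_degree_ladder.mp
    (multiplicityReduction_of_degree_ladder_limit hE hL)).2⟩

/-- Under the rungs every dial is `ω`, so either bridge reads `ω = ω_v` (`= H_mult`, M49/M68). -/
theorem bridges_under_rungs (hE : ∀ D, EquationsForceMultiplicationDeg D) :
    (∀ D, 2 ≤ D → omegaDeg D = omega ℂ) ∧ (BoundedDegreeReduction ↔ omega ℂ ≤ omegaVerif) ∧
      (LimitDegreeReduction ↔ omega ℂ ≤ omegaVerif) := by
  have hB : BoundedDegreeReduction ↔ omega ℂ ≤ omegaVerif := by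
    rw [← multiplicityReduction_iff_omega_le_omegaVerif, multiplicityReduction_iff_degree_ladder]
    exact ⟨fun h => ⟨hE, h⟩, fun h => h.2⟩
  exact ⟨fun D hD => (efmDeg_iff_omegaDeg_eq hD).1 (hE D), hB,
    (boundedDegreeReduction_iff_limit_of_rungs hE).symm.trans hB⟩

end Summit.MatrixMultiplication.MatrixMultiplication.Theorems.GraphEquations

end
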